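import Summits.Ventures.PercRepro.ProfileSkewIdentity

/-!
# PercRepro — `(Π_{q,u})` as «DEFICIENCY ≤ SURPLUS» (p10, gen 0; S5, Corollary 1)

`proofs/SUBCLAIM-S5-p10.md` §2.4, Corollary 1.  With the skew-decomposition identity of
`ProfileSkewIdentity.lean`, the profile inequality `Profile.ProfileIneq M q u` of night-3's `C025Profile`
is EQUIVALENT to

  `Σ_{B : ρ(B) = q} ( [u ≤ ρ(E∖B)]·C(ρ(E∖B), u−q) − #skewExt B (u−q) )  ≤  Σ_{S : ρ(S) = u} ( C(u,q) − C(c(S), u−q) )`,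

because `C(u,q)·price(B) = [u ≤ ρ(E∖B)]·C(ρ(E∖B), u−q)` (`C(m,u)·C(u,q) = C(m,q)·C(m−q,u−q)`) and
`Σ_B #skewExt B (u−q) = Σ_S C(c(S), u−q)`.  Every surplus term is `≥ 0` (a rank-`u` set has at most `u`
coloops): the skew injection `(B, Y) ↦ B ∪ Y` pays the tight locus exactly, and `(Π_{q,u})` says that the
shortfall of the `B`'s whose complement-basis is not skew to `B` is covered by the spare capacity of the
rank-`u` sets with fewer than `u` coloops.  Not a proof of `(Π)`; the exact bookkeeping any charging proof must close.

* `choose_mul_price` — `C(u,q) · Profile.price M q u B = [u ≤ ρ(E∖B)] · C(ρ(E∖B), u − q)`;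
* `deficiency M q u B`, `surplus M q u S` (`surplus_nonneg`);
* **`profileIneq_iff_sum_deficiency_le_sum_surplus`** — the equivalence.
-/

/-! ## The corollary: `(Π_{q,u})` as «deficiency ≤ surplus» -/

namespace PercRepro.Skew

open Finset ThmH Shadow Profile

variable {α : Type*} [DecidableEq α] {M : Matroid α} [M.Finite]

/-- `C(u,q) · price(B) = [u ≤ ρ(E ∖ B)] · C(ρ(E ∖ B), u − q)` (the binomial identity
`C(m,u)·C(u,q) = C(m,q)·C(m−q,u−q)`). -/
theorem choose_mul_price (q u : ℕ) (hqu : q ≤ u) (B : Finset α) :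
    (u.choose q : ℚ) * price M q u B =
      if (u : ℕ∞) ≤ M.eRk ((gr M \ B : Finset α) : Set α) then
        (((M.eRk ((gr M \ B : Finset α) : Set α)).toNat.choose (u - q) : ℕ) : ℚ)
      else 0 := by
  unfold price
  split_ifs with h
  · set p' := (M.eRk ((gr M \ B : Finset α) : Set α)).toNat with hp'
    have hpos : (0 : ℚ) < ((p' + q).choose q : ℕ) := by
      exact_mod_cast Nat.choose_pos (by omega)
    have hmul : (p' + q).choose u * u.choose q = (p' + q).choose q * p'.choose (u - q) := by
      have := Nat.choose_mul (n := p' + q) (k := u) (s := q) hqu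
      rwa [Nat.add_sub_cancel] at this
    rw [mul_div_assoc', div_eq_iff hpos.ne']
    have hmul' : u.choose q * (p' + q).choose u = p'.choose (u - q) * (p' + q).choose q := by
      rw [mul_comm, hmul, mul_comm]
    exact_mod_cast hmul'
  · simp

/-- The deficiency of `B`: the profile count `[u ≤ ρ(E∖B)]·C(ρ(E∖B), u−q)` minus the skew count. -/
noncomputable def deficiency (M : Matroid α) [M.Finite] (q u : ℕ) (B : Finset α) : ℚ :=
  (if (u : ℕ∞) ≤ M.eRk ((gr M \ B : Finset α) : Set α) then
    (((M.eRk ((gr M \ B : Finset α) : Set α)).toNat.choose (u - q) : ℕ) : ℚ) else 0) -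
    ((skewExt M B (u - q)).card : ℚ)

/-- The surplus of a rank-`u` set `S`: `C(u,q) − C(c(S), u−q)` (nonnegative). -/
noncomputable def surplus (M : Matroid α) [M.Finite] (q u : ℕ) (S : Finset α) : ℚ :=
  (u.choose q : ℚ) - (((coloops M S).card.choose (u - q) : ℕ) : ℚ)

/-- The surplus is nonnegative: a rank-`u` set has at most `u` coloops. -/
theorem surplus_nonneg (q u : ℕ) (hqu : q ≤ u) {S : Finset α} (hS : S ∈ levelSet M u) :
    0 ≤ surplus M q u S := by
  rw [mem_levelSet] at hS
  unfold surplus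
  rw [sub_nonneg]
  have h1 : (coloops M S).card ≤ u := card_coloops_le hS.1 hS.2
  have h2 : (coloops M S).card.choose (u - q) ≤ u.choose (u - q) := Nat.choose_le_choose _ h1
  have h3 : u.choose (u - q) = u.choose q := Nat.choose_symm_of_eq_add (by omega)
  rw [h3] at h2
  exact_mod_cast h2

/-- **Corollary 1 (S5)**: the profile inequality at `(q, u)` holds iff the total deficiency is at most the
total surplus. -/
theorem profileIneq_iff_sum_deficiency_le_sum_surplus (q u : ℕ) (hqu : q ≤ u) :
    ProfileIneq M q u ↔
      ∑ B ∈ Rq M q, deficiency M q u B ≤ ∑ S ∈ levelSet M u, surplus M q u S := by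
  classical
  have hpos : (0 : ℚ) < (u.choose q : ℕ) := by exact_mod_cast Nat.choose_pos hqu
  have hid : (∑ B ∈ Rq M q, ((skewExt M B (u - q)).card : ℚ)) =
      ∑ S ∈ levelSet M u, (((coloops M S).card.choose (u - q) : ℕ) : ℚ) := by
    exact_mod_cast sum_card_skewExt_eq_sum_choose (M := M) q u hqu
  have hL : ∑ B ∈ Rq M q, deficiency M q u B =
      (u.choose q : ℚ) * (∑ B ∈ Rq M q, price M q u B) -
        ∑ S ∈ levelSet M u, (((coloops M S).card.choose (u - q) : ℕ) : ℚ) := by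
    unfold deficiency
    rw [Finset.sum_sub_distrib, hid, Finset.mul_sum]
    congr 1
    exact Finset.sum_congr rfl (fun B _ => (choose_mul_price q u hqu B).symm)
  have hR : ∑ S ∈ levelSet M u, surplus M q u S =
      (u.choose q : ℚ) * ((levelSet M u).card : ℚ) -
        ∑ S ∈ levelSet M u, (((coloops M S).card.choose (u - q) : ℕ) : ℚ) := by
    unfold surplus
    rw [Finset.sum_sub_distrib, Finset.sum_const, nsmul_eq_mul, mul_comm]
  rw [hL, hR, sub_le_sub_iff_right]
  unfold ProfileIneq
  constructor
  · intro h
    exact mul_le_mul_of_nonneg_left h hpos.le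
  · intro h
    exact le_of_mul_le_mul_left h hpos

end PercRepro.Skew
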